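import Literature.MathematicalPhysics.QuantumLattice.SpinGaugedFlatSectorBounds
import Literature.MathematicalPhysics.QuantumLattice.DWaveSourceFreePressure
import HarnessLib

/-!
# Crux `SgEndpoint` (stmt-HubbardSuperconductivity-16272, route `ColourTheSpin`), line `birth`,
# stub S1 `stub_bornOppenheimerFlatLimit` — file 1/2: the bounds at fixed gauge coupling `g`

Born–Oppenheimer / strong-magnetic-weight descent of the `Q₈`-spin-gauged Hubbard torus
`H_g = A + g² (1 ⊗ E) + g⁻² (1 ⊗ M)` (`spinGaugedHubbardTorus L U g`) at FIXED side `L`: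

* `exists_card_eq_blockNumber` — the route's `N_L`-block is nonempty (`N_L ≤ 2L² = #orbitals`,
  landed `card_orb_fermionTorus_two`);
* `corridor_order_of_blockGroundState` — the route's corridor clause (stated on the principal
  block `H.toBlock p p`, `p = HasParticleNumber L N`) applied to a block-supported ground state of
  the whole space gives `c ‖Ψ‖² ≤ Re ⟨Ψ, Δ^g† Δ^g Ψ⟩` (restriction / extension-by-zero bookkeeping);
* `rayleigh_single_flat` — the trial state `φ₀ ⊗ |k₀⟩` at a FLAT configuration `k₀` with an
  `N`-block frozen ground state `φ₀` has energy `e₀(k₀) + g² · E(k₀,k₀)` (zero magnetic energy);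
* `blockGroundState_bounds` — for a unit block ground state `Ψ` of `H_g` (eigenvalue `E`, Rayleigh
  bound on the block) and a flat configuration `k₀`:
  `Re ⟨Ψ, A Ψ⟩ ≤ e₀(k₀) + g² cE` and, if `k₀` minimises `e₀` among flat configurations,
  `Σ_{k not flat} ‖Ψ_k‖² ≤ g² (g² cE + |e₀(k₀)| + |E₀(A)|)`, `cE = |Bond L| (1 - 1/8)`:
  the weight off the flat sector is `O(g²)` (electric form `≥ 0`, magnetic form `≥` the non-flat
  weight, `A` block-diagonal with blocks `≥ e₀(k₀)` on flat and `≥ E₀(A)` on all configurations).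

All finite-dimensional and elementary (Kato-type singular perturbation at fixed `L`);
Kogut–Susskind, PRD 11 (1975) 395 §§III–IV (strong/weak coupling limits of the lattice gauge
Hamiltonian). File 2/2 (`…StubBornOppenheimerFlatLimit`) passes to `g → 0⁺` by compactness.
-/

noncomputable section

namespace Summit.HubbardSuperconductivity.ColourTheSpin.SgEndpoint

open Matrix Finset Literature.MathematicalPhysics.QuantumLattice SpinGauged GaugedHubbard
open scoped ComplexOrder Kronecker

section Main

variable (L : ℕ) [NeZero L]

/-! ### The block is nonempty -/

omit [NeZero L] in
/-- **The route's `N_L`-block is nonempty**: `N_L = 2⌊(1-δ)L²/2⌋ ≤ 2L²`, so some occupation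
configuration has exactly `N_L` particles. [folklore] -/
theorem exists_card_eq_blockNumber {δ : ℝ} (hδ : δ ∈ Set.Ioo (0 : ℝ) (1 / 2)) :
    ∃ s : Finset (Orb (FermionTorus 2 L)), s.card = 2 * ⌊(1 - δ) * (L : ℝ) ^ 2 / 2⌋₊ := by
  have hle : 2 * ⌊(1 - δ) * (L : ℝ) ^ 2 / 2⌋₊ ≤ (Finset.univ : Finset (Orb (FermionTorus 2 L))).card := by
    rw [Finset.card_univ, card_orb_fermionTorus_two]
    have h1 : (⌊(1 - δ) * (L : ℝ) ^ 2 / 2⌋₊ : ℝ) ≤ (1 - δ) * (L : ℝ) ^ 2 / 2 :=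
      Nat.floor_le (by nlinarith [hδ.1, hδ.2, sq_nonneg (L : ℝ)])
    have h2 : (1 - δ) * (L : ℝ) ^ 2 / 2 ≤ (L : ℝ) ^ 2 := by nlinarith [hδ.1, hδ.2, sq_nonneg (L : ℝ)]
    have h3 : (⌊(1 - δ) * (L : ℝ) ^ 2 / 2⌋₊ : ℝ) ≤ ((L ^ 2 : ℕ) : ℝ) := by
      rw [Nat.cast_pow]; linarith
    have h4 : ⌊(1 - δ) * (L : ℝ) ^ 2 / 2⌋₊ ≤ L ^ 2 := by exact_mod_cast h3
    omega
  obtain ⟨t, -, ht⟩ := Finset.exists_subset_card_eq hle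
  exact ⟨t, ht⟩

/-! ### The corridor clause on a block-supported ground state of the whole space -/

omit [NeZero L] in
/-- **The route's corridor clause, read on the whole space.** If every ground state `ψ` of the
principal block `H.toBlock p p` (`p ik ↔ #ik.1 = N`) has `c ‖ψ‖² ≤ Re ⟨ψ, R.toBlock p p ψ⟩`, then every
block-supported `Ψ ≠ 0` with `H Ψ = E Ψ` and `E ‖Φ‖² ≤ Re ⟨Φ, H Φ⟩` on block-supported `Φ` has
`c ‖Ψ‖² ≤ Re ⟨Ψ, R Ψ⟩`. [folklore] -/
theorem corridor_order_of_blockGroundState {N : ℕ} (H R : Matrix (Index L Q8) (Index L Q8) ℂ) {c : ℝ}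
    (hcl : ∀ ψ : {ik : Index L Q8 // HasParticleNumber L N ik} → ℂ,
      (ψ ≠ 0 ∧ ∃ E : ℝ, H.toBlock (HasParticleNumber L N) (HasParticleNumber L N) *ᵥ ψ = (E : ℂ) • ψ ∧
        ∀ φ : {ik : Index L Q8 // HasParticleNumber L N ik} → ℂ,
          E * (star φ ⬝ᵥ φ).re ≤
            (star φ ⬝ᵥ H.toBlock (HasParticleNumber L N) (HasParticleNumber L N) *ᵥ φ).re) →
      c * (star ψ ⬝ᵥ ψ).re ≤
        (star ψ ⬝ᵥ R.toBlock (HasParticleNumber L N) (HasParticleNumber L N) *ᵥ ψ).re)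
    {Ψ : Index L Q8 → ℂ} (hsupp : ∀ ik : Index L Q8, ik.1.card ≠ N → Ψ ik = 0) (hΨ0 : Ψ ≠ 0)
    {E : ℝ} (heig : H *ᵥ Ψ = (E : ℂ) • Ψ)
    (hray : ∀ Φ : Index L Q8 → ℂ, (∀ ik : Index L Q8, ik.1.card ≠ N → Φ ik = 0) →
      E * (star Φ ⬝ᵥ Φ).re ≤ (star Φ ⬝ᵥ H *ᵥ Φ).re) :
    c * (star Ψ ⬝ᵥ Ψ).re ≤ (star Ψ ⬝ᵥ R *ᵥ Ψ).re := by
  classical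
  have hsupp' : ∀ ik : Index L Q8, ¬ HasParticleNumber L N ik → Ψ ik = 0 := hsupp
  set ψ : {ik : Index L Q8 // HasParticleNumber L N ik} → ℂ := fun a => Ψ a.1 with hψ
  have h := hcl ψ ⟨?_, E, ?_, ?_⟩
  · rwa [hψ, star_restrict_dotProduct_toBlock_mulVec (HasParticleNumber L N) R Ψ hsupp',
      star_restrict_dotProduct_restrict (HasParticleNumber L N) Ψ Ψ hsupp'] at h
  · -- `ψ ≠ 0`
    intro h0
    apply hΨ0
    rw [← extend_restrict (HasParticleNumber L N) Ψ hsupp']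
    funext b
    by_cases hb : HasParticleNumber L N b
    · have : ψ ⟨b, hb⟩ = 0 := by rw [h0]; rfl
      simpa [hb, hψ] using this
    · simp [hb]
  · -- eigenvector of the block
    rw [hψ, toBlock_mulVec_restrict (HasParticleNumber L N) H Ψ hsupp', heig]
    rfl
  · -- Rayleigh bound on the block
    intro φ
    set Φ : Index L Q8 → ℂ := fun b => if h : HasParticleNumber L N b then φ ⟨b, h⟩ else 0 with hΦ
    have hΦsupp : ∀ ik : Index L Q8, ¬ HasParticleNumber L N ik → Φ ik = 0 :=
      fun ik hik => extend_apply_of_not (HasParticleNumber L N) φ ik hik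
    have hres : (fun a : {ik : Index L Q8 // HasParticleNumber L N ik} => Φ a.1) = φ :=
      restrict_extend (HasParticleNumber L N) φ
    have h1 := hray Φ hΦsupp
    rw [← star_restrict_dotProduct_toBlock_mulVec (HasParticleNumber L N) H Φ hΦsupp,
      ← star_restrict_dotProduct_restrict (HasParticleNumber L N) Φ Φ hΦsupp, hres] at h1
    exact h1

/-! ### The trial state at a flat configuration -/

variable (U : ℝ)

omit [NeZero L] in
/-- A state `φ₀ ⊗ |k₀⟩` with `φ₀` in the `N`-particle sector is supported in the `N`-block. [folklore] -/
theorem single_supported {N : ℕ} (k₀ : Bond L → Q8) {φ₀ : Fock (Orb (FermionTorus 2 L))}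
    (hφ₀ : φ₀ ∈ (nParticleSubmodule N : Submodule ℂ (Fock (Orb (FermionTorus 2 L))))) :
    ∀ ik : Index L Q8, ik.1.card ≠ N → (fun ik : Index L Q8 => if ik.2 = k₀ then φ₀ ik.1 else 0) ik = 0 := by
  intro ik hik
  have h : φ₀ ik.1 = 0 := (mem_nParticleSubmodule_iff N φ₀).1 hφ₀ ik.1 hik
  simp [h]

/-- **Energy of the trial state `φ₀ ⊗ |k₀⟩` at a flat `k₀`**: if `H_F(k₀) φ₀ = e φ₀` then
`⟨φ₀ ⊗ k₀, H_g (φ₀ ⊗ k₀)⟩ = (e + g² |Bond L| (1 - 1/8)) ‖φ₀‖²` — the magnetic energy of a flat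
configuration vanishes and the electric diagonal is the constant `|Bond L|(1 - 1/|Q₈|)`. [folklore] -/
theorem rayleigh_single_flat (g : ℝ) (k₀ : Bond L → Q8) (hflat : ∀ x, holonomy L k₀ x = 1)
    {φ₀ : Fock (Orb (FermionTorus 2 L))} {e : ℝ}
    (heig : (spinGaugedHubbardTorusWith Q8.rep L U 0 0).submatrix (fun s => (s, k₀)) (fun s => (s, k₀)) *ᵥ φ₀ =
      (e : ℂ) • φ₀) :
    star (fun ik : Index L Q8 => if ik.2 = k₀ then φ₀ ik.1 else 0) ⬝ᵥ
        spinGaugedHubbardTorus L U g *ᵥ (fun ik : Index L Q8 => if ik.2 = k₀ then φ₀ ik.1 else 0) =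
      ((e + g ^ 2 * ((Fintype.card (Bond L) : ℝ) * (1 - 1 / 8)) : ℝ) : ℂ) * (star φ₀ ⬝ᵥ φ₀) := by
  set Φ₀ : Index L Q8 → ℂ := fun ik => if ik.2 = k₀ then φ₀ ik.1 else 0 with hΦ₀
  have hA : star Φ₀ ⬝ᵥ spinGaugedHubbardTorusWith Q8.rep L U 0 0 *ᵥ Φ₀ = (e : ℂ) * (star φ₀ ⬝ᵥ φ₀) := by
    conv_lhs => rw [spinGaugedHubbardTorusWith_zero_zero_eq_linkDiag_submatrix Q8.rep L U]
    rw [hΦ₀, star_dotProduct_single_linkDiag_mulVec, heig, dotProduct_smul, smul_eq_mul]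
  have hE : star Φ₀ ⬝ᵥ ((1 : Matrix (Finset (Orb (FermionTorus 2 L))) (Finset (Orb (FermionTorus 2 L))) ℂ) ⊗ₖ
      (electric L : Matrix (Bond L → Q8) _ ℂ)) *ᵥ Φ₀ =
      ((Fintype.card (Bond L) : ℂ) * (1 - 1 / 8)) * (star φ₀ ⬝ᵥ φ₀) := by
    rw [hΦ₀, star_dotProduct_one_kronecker_mulVec_single, electric_apply_self, Q8.card]
    norm_num
  have hM : star Φ₀ ⬝ᵥ ((1 : Matrix (Finset (Orb (FermionTorus 2 L))) (Finset (Orb (FermionTorus 2 L))) ℂ) ⊗ₖ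
      SpinGauged.magnetic Q8.rep L) *ᵥ Φ₀ = 0 := by
    rw [hΦ₀, star_dotProduct_one_kronecker_mulVec_single]
    unfold SpinGauged.magnetic
    rw [diagonal_apply_eq, q8_magnetic_diag_eq_zero_of_flat L k₀ hflat, zero_mul]
  unfold spinGaugedHubbardTorus
  rw [spinGaugedHubbardTorusWith_eq_add Q8.rep L U (g ^ 2) (1 / g ^ 2), add_mulVec, add_mulVec,
    dotProduct_add, dotProduct_add, smul_mulVec, smul_mulVec, dotProduct_smul,
    dotProduct_smul, hA, hE, hM, smul_zero, add_zero, smul_eq_mul]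
  push_cast
  ring

/-- **Variational upper bound at a flat configuration**: a block ground energy `E` (Rayleigh bound
over the `N`-block) satisfies `E ≤ e₀(k₀) + g² |Bond L| (1 - 1/8)` for every flat `k₀`. [folklore] -/
theorem blockEnergy_le_frozen_add {N : ℕ} (hN : ∃ s : Finset (Orb (FermionTorus 2 L)), s.card = N)
    (g : ℝ) (k₀ : Bond L → Q8) (hflat : ∀ x, holonomy L k₀ x = 1) {E : ℝ}
    (hray : ∀ Φ : Index L Q8 → ℂ, (∀ ik : Index L Q8, ik.1.card ≠ N → Φ ik = 0) →
      E * (star Φ ⬝ᵥ Φ).re ≤ (star Φ ⬝ᵥ spinGaugedHubbardTorus L U g *ᵥ Φ).re) :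
    E ≤ ((spinGaugedHubbardTorusWith Q8.rep L U 0 0).submatrix (fun s => (s, k₀)) (fun s => (s, k₀))).minEnergyOn
        (nParticleSubmodule N : Submodule ℂ (Fock (Orb (FermionTorus 2 L)))) +
      g ^ 2 * ((Fintype.card (Bond L) : ℝ) * (1 - 1 / 8)) := by
  obtain ⟨φ₀, hφ₀N, hφ₀1, heig⟩ := exists_unit_groundState_frozen Q8.rep L Q8.star_trace_rep U k₀ hN
  have h := hray _ (single_supported L k₀ hφ₀N)
  rw [rayleigh_single_flat L U g k₀ hflat heig, star_dotProduct_single_self, hφ₀1, mul_one,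
    Complex.one_re, mul_one, Complex.ofReal_re] at h
  exact h

/-! ### The gauge–fermion form over the link configurations -/

omit [NeZero L] in
/-- Components of a block-supported state are `N`-particle vectors. [folklore] -/
theorem component_mem_nParticleSubmodule {N : ℕ} {Ψ : Index L Q8 → ℂ}
    (hsupp : ∀ ik : Index L Q8, ik.1.card ≠ N → Ψ ik = 0) (k : Bond L → Q8) :
    (fun s => Ψ (s, k)) ∈ (nParticleSubmodule N : Submodule ℂ (Fock (Orb (FermionTorus 2 L)))) :=
  (mem_nParticleSubmodule_iff N _).2 fun s hs => hsupp (s, k) hs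

/-- **The gauge–fermion form decomposes over link configurations**:
`⟨Ψ, A Ψ⟩ = Σ_k ⟨Ψ_k, H_F(k) Ψ_k⟩`. [folklore] -/
theorem gaugeFermion_form_eq_sum (Ψ : Index L Q8 → ℂ) :
    star Ψ ⬝ᵥ spinGaugedHubbardTorusWith Q8.rep L U 0 0 *ᵥ Ψ =
      ∑ k : Bond L → Q8, star (fun s => Ψ (s, k)) ⬝ᵥ
        (spinGaugedHubbardTorusWith Q8.rep L U 0 0).submatrix (fun s => (s, k)) (fun s => (s, k)) *ᵥ
          (fun s => Ψ (s, k)) := by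
  conv_lhs => rw [spinGaugedHubbardTorusWith_zero_zero_eq_linkDiag_submatrix Q8.rep L U]
  rw [star_dotProduct_linkDiag_mulVec]

/-- **Lower bound of the gauge–fermion form on a block-supported state**: with `e ≤ e₀(k)` for every
flat `k`, `Re ⟨Ψ, A Ψ⟩ ≥ e · Σ_{k flat} ‖Ψ_k‖² + E₀(A) · Σ_{k not flat} ‖Ψ_k‖²`. [folklore] -/
theorem gaugeFermion_form_ge {N : ℕ} (hN : ∃ s : Finset (Orb (FermionTorus 2 L)), s.card = N)
    {Ψ : Index L Q8 → ℂ} (hsupp : ∀ ik : Index L Q8, ik.1.card ≠ N → Ψ ik = 0) {e : ℝ}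
    (he : ∀ k : Bond L → Q8, (∀ x, holonomy L k x = 1) →
      e ≤ ((spinGaugedHubbardTorusWith Q8.rep L U 0 0).submatrix (fun s => (s, k)) (fun s => (s, k))).minEnergyOn
        (nParticleSubmodule N : Submodule ℂ (Fock (Orb (FermionTorus 2 L))))) :
    e * ∑ k ∈ Finset.univ.filter (fun k : Bond L → Q8 => ∀ x, holonomy L k x = 1),
          (star (fun s => Ψ (s, k)) ⬝ᵥ fun s => Ψ (s, k)).re +
      (spinGaugedHubbardTorusWith Q8.rep L U 0 0).groundEnergy *
        ∑ k ∈ Finset.univ.filter (fun k : Bond L → Q8 => ¬ ∀ x, holonomy L k x = 1),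
          (star (fun s => Ψ (s, k)) ⬝ᵥ fun s => Ψ (s, k)).re ≤
      (star Ψ ⬝ᵥ spinGaugedHubbardTorusWith Q8.rep L U 0 0 *ᵥ Ψ).re := by
  rw [gaugeFermion_form_eq_sum, Complex.re_sum, Finset.mul_sum, Finset.mul_sum,
    ← Finset.sum_filter_add_sum_filter_not Finset.univ (fun k : Bond L → Q8 => ∀ x, holonomy L k x = 1)]
  refine add_le_add (Finset.sum_le_sum fun k hk => ?_) (Finset.sum_le_sum fun k hk => ?_)
  · rw [Finset.mem_filter] at hk
    have h1 := frozen_minEnergyOn_le_rayleigh Q8.rep L Q8.star_trace_rep U k hN _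
      (component_mem_nParticleSubmodule L hsupp k)
    have h0 := EigenvalueContinuation.re_star_dotProduct_self_nonneg (fun s => Ψ (s, k))
    exact le_trans (mul_le_mul_of_nonneg_right (he k hk.2) h0) h1
  · exact groundEnergy_gaugeFermion_le_rayleigh_frozen Q8.rep L Q8.star_trace_rep U k _

/-- `Σ_k ‖Ψ_k‖²` splits into the flat and the non-flat configurations and equals `‖Ψ‖²`. [folklore] -/
theorem sum_flat_add_sum_nonflat (Ψ : Index L Q8 → ℂ) :
    ∑ k ∈ Finset.univ.filter (fun k : Bond L → Q8 => ∀ x, holonomy L k x = 1),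
        (star (fun s => Ψ (s, k)) ⬝ᵥ fun s => Ψ (s, k)).re +
      ∑ k ∈ Finset.univ.filter (fun k : Bond L → Q8 => ¬ ∀ x, holonomy L k x = 1),
        (star (fun s => Ψ (s, k)) ⬝ᵥ fun s => Ψ (s, k)).re = (star Ψ ⬝ᵥ Ψ).re := by
  rw [Finset.sum_filter_add_sum_filter_not, star_dotProduct_self_eq_sum_link, Complex.re_sum]

/-! ### The two bounds on a block ground state -/

/-- **Bounds on a unit block ground state `Ψ` of `H_g`** (`H_g Ψ = E Ψ`, `‖Ψ‖ = 1`, Rayleigh bound on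
the `N`-block), relative to a flat configuration `k₀` minimising the `N`-block frozen energy among
flat configurations, `e = e₀(k₀)`, `cE = |Bond L|(1 - 1/8)`, `E_A = E₀(A)`:
(1) `Re ⟨Ψ, A Ψ⟩ ≤ e + g² cE`; (2) `Σ_{k not flat} ‖Ψ_k‖² ≤ g² (g² cE + |e| + |E_A|)`.
(Energy sandwich: `e (1 - w) + E_A w + g⁻² w ≤ Re⟨A⟩ + g² Re⟨E⟩ + g⁻² Re⟨M⟩ = E ≤ e + g² cE`.)
[folklore] -/
theorem blockGroundState_bounds {N : ℕ} (hN : ∃ s : Finset (Orb (FermionTorus 2 L)), s.card = N)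
    {g : ℝ} (hg : 0 < g) (k₀ : Bond L → Q8) (hflat : ∀ x, holonomy L k₀ x = 1)
    (hmin : ∀ k : Bond L → Q8, (∀ x, holonomy L k x = 1) →
      ((spinGaugedHubbardTorusWith Q8.rep L U 0 0).submatrix (fun s => (s, k₀)) (fun s => (s, k₀))).minEnergyOn
          (nParticleSubmodule N : Submodule ℂ (Fock (Orb (FermionTorus 2 L)))) ≤
        ((spinGaugedHubbardTorusWith Q8.rep L U 0 0).submatrix (fun s => (s, k)) (fun s => (s, k))).minEnergyOn
          (nParticleSubmodule N : Submodule ℂ (Fock (Orb (FermionTorus 2 L)))))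
    {Ψ : Index L Q8 → ℂ} (hsupp : ∀ ik : Index L Q8, ik.1.card ≠ N → Ψ ik = 0) (hΨ1 : star Ψ ⬝ᵥ Ψ = 1)
    {E : ℝ} (heig : spinGaugedHubbardTorus L U g *ᵥ Ψ = (E : ℂ) • Ψ)
    (hray : ∀ Φ : Index L Q8 → ℂ, (∀ ik : Index L Q8, ik.1.card ≠ N → Φ ik = 0) →
      E * (star Φ ⬝ᵥ Φ).re ≤ (star Φ ⬝ᵥ spinGaugedHubbardTorus L U g *ᵥ Φ).re) :
    (star Ψ ⬝ᵥ spinGaugedHubbardTorusWith Q8.rep L U 0 0 *ᵥ Ψ).re ≤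
        ((spinGaugedHubbardTorusWith Q8.rep L U 0 0).submatrix (fun s => (s, k₀)) (fun s => (s, k₀))).minEnergyOn
            (nParticleSubmodule N : Submodule ℂ (Fock (Orb (FermionTorus 2 L)))) +
          g ^ 2 * ((Fintype.card (Bond L) : ℝ) * (1 - 1 / 8)) ∧
      ∑ k ∈ Finset.univ.filter (fun k : Bond L → Q8 => ¬ ∀ x, holonomy L k x = 1),
          (star (fun s => Ψ (s, k)) ⬝ᵥ fun s => Ψ (s, k)).re ≤
        g ^ 2 * (g ^ 2 * ((Fintype.card (Bond L) : ℝ) * (1 - 1 / 8)) +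
          |((spinGaugedHubbardTorusWith Q8.rep L U 0 0).submatrix (fun s => (s, k₀)) (fun s => (s, k₀))).minEnergyOn
              (nParticleSubmodule N : Submodule ℂ (Fock (Orb (FermionTorus 2 L))))| +
          |(spinGaugedHubbardTorusWith Q8.rep L U 0 0).groundEnergy|) := by
  -- names
  set A := spinGaugedHubbardTorusWith Q8.rep L U 0 0 with hA
  set e := (A.submatrix (fun s => (s, k₀)) (fun s => (s, k₀))).minEnergyOn
    (nParticleSubmodule N : Submodule ℂ (Fock (Orb (FermionTorus 2 L)))) with he
  set cE : ℝ := (Fintype.card (Bond L) : ℝ) * (1 - 1 / 8) with hcE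
  set EA := A.groundEnergy with hEA
  set wF := ∑ k ∈ Finset.univ.filter (fun k : Bond L → Q8 => ∀ x, holonomy L k x = 1),
    (star (fun s => Ψ (s, k)) ⬝ᵥ fun s => Ψ (s, k)).re with hwF
  set w := ∑ k ∈ Finset.univ.filter (fun k : Bond L → Q8 => ¬ ∀ x, holonomy L k x = 1),
    (star (fun s => Ψ (s, k)) ⬝ᵥ fun s => Ψ (s, k)).re with hw
  -- the energy `E = Re ⟨Ψ, H Ψ⟩` and its three pieces
  have hEform : (star Ψ ⬝ᵥ spinGaugedHubbardTorus L U g *ᵥ Ψ).re = E := by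
    rw [EigenvalueContinuation.re_star_dotProduct_mulVec_of_eigen heig, hΨ1, Complex.one_re, mul_one]
  have hsplit : (star Ψ ⬝ᵥ spinGaugedHubbardTorus L U g *ᵥ Ψ).re =
      (star Ψ ⬝ᵥ A *ᵥ Ψ).re +
        g ^ 2 * (star Ψ ⬝ᵥ ((1 : Matrix (Finset (Orb (FermionTorus 2 L))) (Finset (Orb (FermionTorus 2 L))) ℂ) ⊗ₖ
          (electric L : Matrix (Bond L → Q8) _ ℂ)) *ᵥ Ψ).re +
        (1 / g ^ 2) * (star Ψ ⬝ᵥ ((1 : Matrix (Finset (Orb (FermionTorus 2 L))) (Finset (Orb (FermionTorus 2 L))) ℂ) ⊗ₖ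
          SpinGauged.magnetic Q8.rep L) *ᵥ Ψ).re := by
    unfold spinGaugedHubbardTorus
    rw [spinGaugedHubbardTorusWith_eq_add Q8.rep L U (g ^ 2) (1 / g ^ 2), add_mulVec, add_mulVec,
      dotProduct_add, dotProduct_add, smul_mulVec, smul_mulVec, dotProduct_smul,
      dotProduct_smul, smul_eq_mul, smul_eq_mul, Complex.add_re, Complex.add_re, Complex.re_ofReal_mul,
      Complex.re_ofReal_mul]
  have hEl := re_electric_form_nonneg (G := Q8) L Ψ
  have hMag := q8_sum_nonflat_norm_sq_le_magnetic_form L Ψ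
  have hMag0 := q8_re_magnetic_form_nonneg L Ψ
  -- upper bound on `E`
  have hup : E ≤ e + g ^ 2 * cE := blockEnergy_le_frozen_add L U hN g k₀ hflat hray
  -- lower bound on the gauge–fermion form
  have hlow : e * wF + EA * w ≤ (star Ψ ⬝ᵥ A *ᵥ Ψ).re :=
    gaugeFermion_form_ge L U hN hsupp (fun k hk => hmin k hk)
  have hsum : wF + w = 1 := by
    rw [hwF, hw, sum_flat_add_sum_nonflat, hΨ1, Complex.one_re]
  have hg2 : 0 < g ^ 2 := by positivity
  have hw0 : 0 ≤ w := Finset.sum_nonneg fun k _ => EigenvalueContinuation.re_star_dotProduct_self_nonneg _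
  have hwF0 : 0 ≤ wF := Finset.sum_nonneg fun k _ => EigenvalueContinuation.re_star_dotProduct_self_nonneg _
  have hw1 : w ≤ 1 := by linarith
  refine ⟨?_, ?_⟩
  · -- (1): drop the nonnegative electric and magnetic forms
    have : (star Ψ ⬝ᵥ A *ᵥ Ψ).re ≤ (star Ψ ⬝ᵥ spinGaugedHubbardTorus L U g *ᵥ Ψ).re := by
      rw [hsplit]
      have h1 : 0 ≤ g ^ 2 * (star Ψ ⬝ᵥ ((1 : Matrix (Finset (Orb (FermionTorus 2 L))) (Finset (Orb (FermionTorus 2 L))) ℂ) ⊗ₖ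
          (electric L : Matrix (Bond L → Q8) _ ℂ)) *ᵥ Ψ).re := mul_nonneg hg2.le hEl
      have h2 : 0 ≤ (1 / g ^ 2) * (star Ψ ⬝ᵥ ((1 : Matrix (Finset (Orb (FermionTorus 2 L))) (Finset (Orb (FermionTorus 2 L))) ℂ) ⊗ₖ
          SpinGauged.magnetic Q8.rep L) *ᵥ Ψ).re := mul_nonneg (by positivity) hMag0
      linarith
    rw [hEform] at this
    linarith
  · -- (2): `g⁻² w ≤ g² cE + e w - EA w ≤ g² cE + |e| + |EA|`
    have hkey : (star Ψ ⬝ᵥ A *ᵥ Ψ).re + (1 / g ^ 2) * w ≤ e + g ^ 2 * cE := by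
      have h1 : 0 ≤ g ^ 2 * (star Ψ ⬝ᵥ ((1 : Matrix (Finset (Orb (FermionTorus 2 L))) (Finset (Orb (FermionTorus 2 L))) ℂ) ⊗ₖ
          (electric L : Matrix (Bond L → Q8) _ ℂ)) *ᵥ Ψ).re := mul_nonneg hg2.le hEl
      have h2 : (1 / g ^ 2) * w ≤ (1 / g ^ 2) * (star Ψ ⬝ᵥ ((1 : Matrix (Finset (Orb (FermionTorus 2 L))) (Finset (Orb (FermionTorus 2 L))) ℂ) ⊗ₖ
          SpinGauged.magnetic Q8.rep L) *ᵥ Ψ).re := mul_le_mul_of_nonneg_left hMag (by positivity)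
      have h3 := hsplit
      rw [hEform] at h3
      linarith
    have hewF : e * wF = e - e * w := by rw [show wF = 1 - w by linarith]; ring
    have h4 : (1 / g ^ 2) * w ≤ g ^ 2 * cE + |e| + |EA| := by
      have h5 : e * w ≤ |e| := le_trans (le_abs_self _) (by
        rw [abs_mul, abs_of_nonneg hw0]; exact mul_le_of_le_one_right (abs_nonneg e) hw1)
      have h6 : -(EA * w) ≤ |EA| := by
        rw [← abs_neg]
        refine le_trans (le_abs_self _) ?_
        rw [neg_mul_eq_neg_mul, abs_mul, abs_of_nonneg hw0]
        exact mul_le_of_le_one_right (abs_nonneg _) hw1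
      linarith
    have h7 : w = g ^ 2 * ((1 / g ^ 2) * w) := by field_simp
    rw [h7]
    exact mul_le_mul_of_nonneg_left h4 hg2.le

end Main

section Registered

/-- **Registered helper `helper_flatLimitBounds` of stub S1** (one-line restatement of
`blockGroundState_bounds` with all binders explicit, outside the section variables). [folklore] -/
theorem helper_flatLimitBounds : ∀ (L : ℕ) [NeZero L] (U : ℝ) (N : ℕ), (∃ s : Finset (Orb (FermionTorus 2 L)), s.card = N) → ∀ (g : ℝ), 0 < g → ∀ (k₀ : GaugedHubbard.Bond L → Q8), (∀ x, SpinGauged.holonomy L k₀ x = 1) → (∀ k : GaugedHubbard.Bond L → Q8, (∀ x, SpinGauged.holonomy L k x = 1) → ((spinGaugedHubbardTorusWith Q8.rep L U 0 0).submatrix (fun s => (s, k₀)) (fun s => (s, k₀))).minEnergyOn (nParticleSubmodule N : Submodule ℂ (Fock (Orb (FermionTorus 2 L)))) ≤ ((spinGaugedHubbardTorusWith Q8.rep L U 0 0).submatrix (fun s => (s, k)) (fun s => (s, k))).minEnergyOn (nParticleSubmodule N : Submodule ℂ (Fock (Orb (FermionTorus 2 L))))) → ∀ (Ψ : SpinGauged.Index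 L Q8 → ℂ), (∀ ik : SpinGauged.Index L Q8, ik.1.card ≠ N → Ψ ik = 0) → star Ψ ⬝ᵥ Ψ = 1 → ∀ (E : ℝ), spinGaugedHubbardTorus L U g *ᵥ Ψ = (E : ℂ) • Ψ → (∀ Φ : SpinGauged.Index L Q8 → ℂ, (∀ ik : SpinGauged.Index L Q8, ik.1.card ≠ N → Φ ik = 0) → E * (star Φ ⬝ᵥ Φ).re ≤ (star Φ ⬝ᵥ spinGaugedHubbardTorus L U g *ᵥ Φ).re) → (star Ψ ⬝ᵥ spinGaugedHubbardTorusWith Q8.rep L U 0 0 *ᵥ Ψ).re ≤ ((spinGaugedHubbardTorusWith Q8.rep L U 0 0).submatrix (fun s => (s, k₀)) (fun s => (s, k₀))).minEnergyOn (nParticleSubmodule N : Submodule ℂ (Fock (Orb (FermionTorus 2 L)))) + g ^ 2 * ((Fintype.card (GaugedHubbard.Bond L) : ℝ) * (1 - 1 / 8)) ∧ ∑ k ∈ Finset.univ.filter (fun k : GaugedHubbard.Bond L → Q8 => ¬ ∀ x, SpinGauged.holonomy L k x = 1), (star (fun s => Ψ (s, k)) ⬝ᵥ fun s => Ψ (s,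 k)).re ≤ g ^ 2 * (g ^ 2 * ((Fintype.card (GaugedHubbard.Bond L) : ℝ) * (1 - 1 / 8)) + |((spinGaugedHubbardTorusWith Q8.rep L U 0 0).submatrix (fun s => (s, k₀)) (fun s => (s, k₀))).minEnergyOn (nParticleSubmodule N : Submodule ℂ (Fock (Orb (FermionTorus 2 L))))| + |(spinGaugedHubbardTorusWith Q8.rep L U 0 0).groundEnergy|) :=
  fun L _ U _ hN _ hg k₀ hflat hmin _ hsupp hΨ1 _ heig hray =>
    blockGroundState_bounds L U hN hg k₀ hflat hmin hsupp hΨ1 heig hray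

end Registered

end Summit.HubbardSuperconductivity.ColourTheSpin.SgEndpoint

end
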